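import Summits.BirchSwinnertonDyer.BirchSwinnertonDyer.Theorems.GenusKolyvaginAtTwoExactDescentAtTwoOfFacts
import Summits.BirchSwinnertonDyer.BirchSwinnertonDyer.Theorems.CMKolyvaginAtInertTwoCMExactDescentAtTwoLocal
import Summits.BirchSwinnertonDyer.Rank1Residual.P2.HeegnerIndexAtTwoOverKDescent

/-!
# Route `GenusKolyvaginAtTwo` is a TRANSFER line at `2`: granted exactness over `K` (crux #3) on a
# habitat curve, `BSD₂(E) ⟺ BSD₂(E^{(d_K)})` — kernel object, modulo five published named facts

HONEST FRAMING (cell `bsd-f1-sign2`, seat `bsd-line-gk2-p3`, D-0145 line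
`route-BirchSwinnertonDyer-GenusKolyvaginAtTwo`, DRAFT rev 2): THEOREMS ONLY — nothing asserted, nothing
booked, BSD is not proved by this. Companion of `GenusKolyvaginAtTwoExactDescentAtTwoOfFacts.lean`
(`GenusExactDescent.exactDescentAtTwo_of_facts`: crux #4 `ExactDescentAtTwo`, item 22138, closed modulo
GZ, Kolyvagin, GZK, modularity, Milne any-model). That file gives the direction the route's `closes`
consumes (`BSD₂(Wd) ⟹ BSD₂(W)`); this file records the EQUIVALENCE, which is the honest content of the
line for planning (gk2-p2's finding, cell STATUS 2026-08-27T22:52Z, made a kernel object against THIS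
route's binders): even with crux #2 (supply of an admissible `K` and a `2`-indivisible derived point)
and crux #3 (exactness `#Ш(E_K/K)[2^∞] = 4^{M₀}`) proved, a habitat curve `E` gets `BSD₂(E)` EXACTLY
when its Sel₂-minimal rank-one twin `E^{(d_K)}` gets `BSD₂` (crux #6) — and conversely every rank-0
`BSD₂` anchor on the habitat is TRANSFERRED to a new rank-1 `BSD₂` result. Neither member's `BSD₂` is
produced inside the line.

Mechanism: the `K`-side valuation identity `ord₂(4·I²/(c²·w_K²·∏_w c_w(E_K))) = 2M₀ = ord₂ #Ш(E_K/K)`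
(`I = [E(K):ℤP₀]` with `ord₂ I = M₀` — McCallum Lemma 5.1 at `2`, `X11b.Three.Koly`; `w_K = 2`;
`∏_w c_w(E_K) = (∏_ℓ c_ℓ)²`, `X11b.tamagawaProduct_baseChange_eq_sq_of_allSplit`; `c`, `∏c_ℓ` odd)
feeds sub-lane «bsd-p2»'s two-sided descent `P2.bsdp_iff_bsdp_twist_of_heegnerIndexOverK` (Gross–Zagier
V.(2.2) exact over `K` + Milne 1972 Thm 1 on the globally minimal model `W ⊗ K`, minimal at a Heegner
field by `CMExactDescent.isGloballyMinimal_baseChange_of_heegner`). The twin's analytic rank is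
EXACTLY one by `GenusExactDescent.analyticRank_twist_eq_one_of_rankZero`. Binders: `hGZ`, `hKo`,
`hGZK`, `hmod` and `hMilne : Milne1972.bsdQuotient_baseChange_quadratic` (minimal-model form).

References: [GrossZagier1986] V.(2.2); [Milne1972ArithmeticAV] §1 Thm 1; [Kolyvagin1990] Thm A;
[McCallumLMS1991] §5 Lemma 5.1; [JetchevSkinnerWan2017] §7.3.1 (eq:tamK); [Miller2011LMS] Def. 1.1.
-/

set_option autoImplicit false
-- the Theorems namespace of this sub repeats the summit name by design (D-0017 nested layout)
set_option linter.dupNamespace false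

noncomputable section

open scoped Classical

open WeierstrassCurve NumberField Literature.NumberTheory.EllipticCurves
  Literature.NumberTheory.EllipticCurves.ModularForms
  Literature.NumberTheory.EllipticCurves.Rank1Residual
  Literature.NumberTheory.EllipticCurves.Rank1Residual.Typed
  Literature.NumberTheory.EllipticCurves.KrizLi2019
  Summit.BirchSwinnertonDyer.Rank1Residual
  Summit.BirchSwinnertonDyer.Rank1Residual.AdditivePotMult
  Summit.BirchSwinnertonDyer.BirchSwinnertonDyer.Theorems.CMExactDescent

namespace Summit.BirchSwinnertonDyer.BirchSwinnertonDyer.Theorems.GenusExactDescent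

/-- **TRANSFER THEOREM of the line `GenusKolyvaginAtTwo` (what cruxes #2 + #3 buy, modulo print).**
Granted the published facts `hGZ`, `hKo`, `hGZK`, `hmod` and Milne 1972 Thm 1 on globally minimal
models (`hMilne : Milne1972.bsdQuotient_baseChange_quadratic`): for `W/ℚ` globally minimal of analytic
rank `0` with `ρ_{E,2^n}` onto for all `n ≥ 1` and odd Tamagawa product, `K` imaginary quadratic with
odd `d_K ≠ -3` and the Heegner hypothesis, a datum `Dt` at level `N_E` with odd Manin constant, the
conductor-`1` datum `d₁` with `y_K = P(1)` of infinite order and `2^{M₀} ∥ y_K` in `E(K[1])`, and the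
EXACTNESS `#Ш(E_K/K)[2^∞] = 4^{M₀}` (crux #3's conclusion): for every globally minimal model `Wd` of
the twin `E^{(d_K)}`, **`BSD(W, 2) ⟺ BSD(Wd, 2)`**. CONDITIONAL on five published facts; nothing
booked. [cite: GrossZagier1986, V.(2.2)] [cite: Milne1972ArithmeticAV, §1 Thm. 1] [cite: Kolyvagin1990, Thm. A]
[cite: McCallumLMS1991, §5 Lemma 5.1] [cite: Miller2011LMS, Def. 1.1] -/
theorem bsdp_iff_bsdp_twin_of_exact_of_facts
    (hGZ : ∀ (N : ℕ) [NeZero N] (W : WeierstrassCurve ℚ) (K : Type) [Field K] [NumberField K],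
      gross_zagier N W K)
    (hKo : ∀ (N : ℕ) [NeZero N] (W : WeierstrassCurve ℚ) (K : Type) [Field K] [NumberField K],
      kolyvagin N W K)
    (hGZK : rank_eq_analyticRank_of_analyticRank_le_one) (hmod : hasEntireLFunction_rat)
    (hMilne : Milne1972.bsdQuotient_baseChange_quadratic) :
    ∀ (W : WeierstrassCurve ℚ) [W.IsElliptic] [W.IsGloballyMinimal] [NeZero (W.conductorNorm ℤ)],
      W.analyticRank = 0 → (∀ n : ℕ, 0 < n → W.HasSurjectiveModNGaloisRep ((2 : ℤ) ^ n)) →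
      Odd W.tamagawaProduct →
      ∀ (K : Type) [Field K] [NumberField K], IsImaginaryQuadratic K → Odd (NumberField.discr K) →
      NumberField.discr K ≠ -3 → SatisfiesHeegnerHypothesis (W.conductorNorm ℤ) K →
      ∀ (Dt : ModularParametrizationData W (W.conductorNorm ℤ)), Odd Dt.c →
      ∀ (β : ℤ) (ι : K →+* ℂ) (d₁ : KolyvaginHeegnerData Dt β ι 1), ¬ IsOfFinAddOrder d₁.derivedPoint →
      ∀ (M₀ : ℕ),
        (∃ Q : (W.baseChange (ringClassField K ι 1)).toAffine.Point,
          ((2 ^ M₀ : ℕ) : ℤ) • Q = d₁.derivedPoint) →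
        (¬ ∃ Q : (W.baseChange (ringClassField K ι 1)).toAffine.Point,
          ((2 ^ (M₀ + 1) : ℕ) : ℤ) • Q = d₁.derivedPoint) →
        Nat.card (AddCommGroup.primaryComponent (W.baseChange K).sha 2) = 2 ^ (2 * M₀) →
      ∀ (Wd : WeierstrassCurve ℚ) [Wd.IsElliptic] [Wd.IsGloballyMinimal],
        (∃ C : WeierstrassCurve.VariableChange ℚ, C • W.quadraticTwist (NumberField.discr K : ℚ) = Wd) →
        (BSDp W 2 ↔ BSDp Wd 2) := by
  intro W _ _ _ hr0 hρ hT K _ _ hK hodd h3 hH Dt hc β ι d₁ hy M₀ hdiv hndiv hsha Wd _ _ hWd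
  haveI : Fact (Nat.Prime 2) := ⟨Nat.prime_two⟩
  haveI hEK : (W.baseChange K).IsElliptic := isElliptic_baseChange' W K
  have h2 : Module.finrank ℚ K = 2 := hK.1
  haveI hminK : (W.baseChange K).IsGloballyMinimal := isGloballyMinimal_baseChange_of_heegner W K h2 hH
  have hD0 : (NumberField.discr K : ℚ) ≠ 0 := by exact_mod_cast NumberField.discr_ne_zero K
  haveI hEt : (W.quadraticTwist (NumberField.discr K : ℚ)).IsElliptic :=
    W.isElliptic_quadraticTwist hD0
  obtain ⟨hD4, hDlt⟩ := discr_emod_four_and_lt_of_odd hK hodd h3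
  have hw2 : Units.torsionOrder K = 2 :=
    Literature.NumberTheory.QuadraticFields.Quadratic.torsionOrder_eq_two_of_discr_lt_neg_four h2 hDlt
  have hc0 : Dt.c ≠ 0 := by
    obtain ⟨k, hk⟩ := hc
    omega
  have hρ2 : W.HasSurjectiveModNGaloisRep 2 := by
    simpa using hρ 1 one_pos
  -- the Heegner point `P₀ ∈ E(K)` below `P(1)`, for the item's own `Dt`
  obtain ⟨P₀, Hd, hP₀, hP₀K⟩ := exists_heegnerPoint_map_eq_derivedPoint_one hK hH d₁
  have hPinf : ¬ IsOfFinAddOrder P₀ := by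
    intro hfin
    apply hy
    rw [← hP₀K]
    exact (WeierstrassCurve.Affine.Point.map (W' := W)
      (algebraMap K (ringClassField K ι 1)).toRatAlgHom).isOfFinAddOrder hfin
  -- ranks
  have hrt : (W.quadraticTwist (NumberField.discr K : ℚ)).analyticRank = 1 :=
    analyticRank_twist_eq_one_of_rankZero W K (hGZ _ W K) (hKo _ W K) hGZK hmod hK hH hr0
      ⟨Dt, Hd, ι, hP₀⟩ hPinf
  have hrK : (W.baseChange K).analyticRank = 1 :=
    (P2.analyticRank_baseChange_eq_one_iff W K hmod h2).mpr (Or.inr ⟨hr0, hrt⟩)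
  -- rank `E(K) = 1`, `Ш(E_K)` finite (Kolyvagin)
  obtain ⟨hrkK, hShaK⟩ := hKo (W.conductorNorm ℤ) W K hK hH ⟨Dt, Hd, ι, hP₀⟩ hPinf
  haveI hfinK : Finite (W.baseChange K).sha := hShaK
  -- `ord₂ [E(K) : ℤP₀] = M₀`
  have htor1 : ∀ (M : ℕ) (R : (W.baseChange (ringClassField K ι 1)).toAffine.Point),
      ((2 ^ M : ℕ) : ℤ) • R = 0 → R = 0 :=
    fun M R hR ↦ eq_zero_of_two_pow_smul_eq_zero_ringClassField W hK hodd hH hρ2 ι M R hR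
  have hdivK : ∃ Q : (W.baseChange K).toAffine.Point, ((2 ^ M₀ : ℕ) : ℤ) • Q = P₀ :=
    (X11b.Three.Koly.pDiv_one_iff_exists_zsmul_eq hK d₁ P₀ hP₀K 2 M₀ (htor1 M₀)).mp hdiv
  have hndivK : ¬ ∃ Q : (W.baseChange K).toAffine.Point, ((2 ^ (M₀ + 1) : ℕ) : ℤ) • Q = P₀ :=
    fun h ↦ hndiv ((X11b.Three.Koly.pDiv_one_iff_exists_zsmul_eq hK d₁ P₀ hP₀K 2 (M₀ + 1)
      (htor1 (M₀ + 1))).mpr h)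
  have hiv : ∀ x : (W.baseChange K).toAffine.Point, 2 • x = 0 → x = 0 :=
    fun x hx ↦ eq_zero_of_two_smul_eq_zero_baseChange W hK hodd hH hρ2 x hx
  haveI : Finite (AddCommGroup.torsion (W.baseChange K).toAffine.Point) :=
    WeierstrassCurve.finite_torsion_point (W := W.baseChange K)
  obtain ⟨cc, Q, hcQ, hcker⟩ :=
    X11b.RankOne.exists_coord_of_mordellWeilRank_eq_one (W.baseChange K) hrkK
  have hidx : padicValNat 2 (AddSubgroup.zmultiples P₀).index = M₀ :=
    X11b.Three.Koly.padicValNat_index_zmultiples_eq_of_divisibility (p := 2) cc Q hcQ hcker hiv P₀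
      hdivK hndivK
  -- the valuation identity in the currency of «bsd-p2»
  set I := (AddSubgroup.zmultiples P₀).index with hI_def
  have hI0 : I ≠ 0 := fun hI ↦ by
    have hh := P2.torsionOrder_sq_mul_canonicalHeight_eq_index_sq_mul_regulator (W.baseChange K)
      hrkK P₀ hPinf
    rw [← hI_def, hI, Nat.cast_zero, zero_pow two_ne_zero, zero_mul, mul_eq_zero,
      pow_eq_zero_iff two_ne_zero, Nat.cast_eq_zero] at hh
    exact hh.elim (W.baseChange K).torsionOrder_pos_holds.ne'
      (fun h0 ↦ hPinf ((Affine.Point.canonicalHeight_eq_zero_iff_holds P₀).mp h0))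
  have hsplit : ∀ (ℓ : ℕ) [Fact ℓ.Prime], ℓ ∣ W.conductorNorm ℤ → X11b.SplitsIn K ℓ :=
    fun ℓ _ hℓN ↦ hH ℓ Fact.out hℓN
  have hTamK : ((W.baseChange K).tamagawaProduct : ℚ) = (W.tamagawaProduct : ℚ) ^ 2 := by
    rw [X11b.tamagawaProduct_baseChange_eq_sq_of_allSplit W K h2 hsplit]
    push_cast
    rfl
  set q : ℚ := 4 * (I : ℚ) ^ 2 /
      ((Dt.c : ℚ) ^ 2 * (Units.torsionOrder K : ℚ) ^ 2 * ((W.baseChange K).tamagawaProduct : ℚ))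
    with hq_def
  have hcQ0 : (Dt.c : ℚ) ≠ 0 := by exact_mod_cast hc0
  have hcW0 : (W.tamagawaProduct : ℚ) ≠ 0 := by exact_mod_cast W.tamagawaProduct_pos_holds.ne'
  have hIQ0 : (I : ℚ) ≠ 0 := by exact_mod_cast hI0
  have hq' : q = ((I : ℚ) / ((Dt.c : ℚ) * (W.tamagawaProduct : ℚ))) ^ 2 := by
    rw [hq_def, hw2, hTamK]
    push_cast
    field_simp
    ring
  have hvc : padicValRat 2 (Dt.c : ℚ) = 0 := by
    rw [padicValRat.of_int, padicValInt.eq_zero_of_not_dvd (fun h2c ↦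
      (Int.not_even_iff_odd.mpr hc) (even_iff_two_dvd.mpr h2c))]
    rfl
  have hvcW : padicValRat 2 (W.tamagawaProduct : ℚ) = 0 := by
    rw [padicValRat.of_nat, padicValNat.eq_zero_of_not_dvd hT.not_two_dvd_nat]
    rfl
  have hval : padicValRat 2 q = 2 * (M₀ : ℤ) := by
    rw [hq', padicValRat.pow, padicValRat.div hIQ0 (mul_ne_zero hcQ0 hcW0),
      padicValRat.mul hcQ0 hcW0, hvc, hvcW, padicValRat.of_nat, hidx]
    push_cast
    ring
  have hshaV : padicValNat 2 (W.baseChange K).shaOrder = 2 * M₀ := by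
    rw [X11b.Three.Koly.padicValNat_shaOrder_eq (W.baseChange K) 2, hsha, padicValNat.prime_pow]
  have hv : padicValRat 2
      (4 * ((AddSubgroup.zmultiples P₀).index : ℚ) ^ 2 /
        ((Dt.c : ℚ) ^ 2 * (Units.torsionOrder K : ℚ) ^ 2 *
          ((W.baseChange K).tamagawaProduct : ℚ))) =
      padicValNat 2 (W.baseChange K).shaOrder := by
    rw [← hI_def, ← hq_def, hval, hshaV]
    push_cast
    ring
  exact P2.bsdp_iff_bsdp_twist_of_heegnerIndexOverK W 2 K Wd (W.conductorNorm ℤ) Dt Hd ι P₀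
    (hGZ _ W K) (hKo _ W K) hGZK hmod hMilne hK hH hP₀ hc0 hrK hWd hv

end Summit.BirchSwinnertonDyer.BirchSwinnertonDyer.Theorems.GenusExactDescent

end
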